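import Summits.BirchSwinnertonDyer.Rank1Residual.GaloisImage.KatoExpStarFiniteLevel
import HarnessLib

/-!
# The SCALAR CORE of LEMMA SAT (rider (ii) of `KatoExpStarFiniteLevelAt`) — pure `p`-adic algebra,
# stated over the semi-local algebra `ℚ_p ⊗_ℚ ℚ(ζ_m)` and its lattice `cycIntLattice p m`
# (cell `bsd-addord`, seat w2-acc4 gen 2; route W2 `KimAtThreeKolyvagin`, crux
# `KatoKuriharaPortThreeShared` = stmt-BirchSwinnertonDyer-19560, residual ⟨C1⟩ clause (C1.c))

HONEST FRAMING: theorems only (no definition, no named fact, no `sorry`); nothing is booked; BSD is not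
proved by any of this; the crux 19560 is NOT closed by this file.  State of record (HOME STATUS l.959 /
l.962): 19560 ⟸ ⟨C1⟩ (the FINE KATO PACKAGE) alone (w2-c3 g5 p471554), and ⟨C1⟩ is CONSTRUCTION-SHAPED:
its clauses (C1.b)/(C1.c) — the rider `KatoExpStarFiniteLevelAt` (i)/(ii) — become kernel-provable only
once the Bloch–Kato dual exponential exists in the tree (definition item `defn-BlochKatoDualExponential`)
through kim3's LEMMA L + SAT₀ (memo KIM3-W2-C1-g11 §2.2–§2.4 = r1's LEMMA SAT, ROUTE-1 §53.3/§53.12).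
THIS FILE lands NOW the part of that argument which does not depend on the missing object: the SCALAR
step.  Everything `exp*`-dependent stays displayed as hypotheses on abstract data (`τ`, `Λ₀`, `M`).

## What

Fix a prime `p` and a `ℚ_p`-algebra `A` (the intended `A` is the semi-local algebra
`ℚ_p ⊗_ℚ ℚ(ζ_m) = ∏_{𝔓 ∣ p} ℚ(μ_m)_𝔓` of rider (ii), or one factor `K_𝔓`), a `ℚ_p`-linear functional
`τ : A → ℚ_p` (intended: the trace), `ℤ_p`-submodules `L` ("the integers", intended `cycIntLattice p m =
ℤ_p ⊗ ℤ[ζ_m]`) and `M` (intended: the `ℤ_p`-span of the semi-local values `exp*_ω(H¹(K_𝔓, T))`), and a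
set `Λ₀ ⊆ A` (intended: `log_ω E₀`).  HYPOTHESES (all three are what kim3 §2.4 (β)–(ε) / r1 §53.3 supply
for Kato's witnesses; here they are DISPLAYED): (hL) `τ(o·ℓ) ∈ ℤ_p` for `o ∈ L`, `ℓ ∈ Λ₀`;
(hM) `τ(μ·ℓ) ∈ ℤ_p` for `μ ∈ M`, `ℓ ∈ Λ₀` (i.e. `M ⊆ Λ₀^∨`: [BK90] Prop. 3.8 + local Tate duality);
(hu) some `ℓ ∈ Λ₀` has `τ(ℓ) ∈ ℤ_pˣ` (kim3 (γ)(δ): `Tr(Λ₀) = ℤ_p`).  THEN: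

* `norm_le_one_of_algebraMap_eq_add` — **SAT₀**: `(L + M) ∩ ℚ_p ⊆ ℤ_p`
  (`x ⊗ 1 = o + μ ⟹ ‖x‖ ≤ 1`; proof: multiply by `ℓ`, apply `τ`, ultrametric inequality);
* `toZModPow_eq_of_sub_eq_smul_of_sub_eq_smul` — the **(ii)-SHAPED SCALAR CONCLUSION**: if
  `e ⊗ 1 − v = p^{k+1}·μ` (`μ ∈ M`: "`exp*_ω(h) − p^tΛ_{0,r}(y) ∈ p^{k+1}·M`", the `exp*`-side input) and
  `v − s ⊗ 1 = p^{k+1}·l` (`l ∈ L`: the PREMISE of rider (ii) verbatim, `v = p^t · Λ_{0,r}(y)`), then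
  `e ≡ s (mod p^{k+1})` as `PadicInt.toZModPow (k+1) e = PadicInt.toZModPow (k+1) s` — the conclusion
  of rider (ii) once `Λfin(loc κ₀) := toZModPow (k+1) e`;
* `toZModPow_eq_toZModPow_of_premises` — **D-53-7 CONSISTENCY**: two premises `v − s ⊗ 1 = p^{k+1}·l`,
  `v′ − s′ ⊗ 1 = p^{k+1}·l′` with `v′ − v ∈ p^{k+1}·M` give `s ≡ s′ (mod p^{k+1})`;
* §2: the lattice `cycIntLattice p m` of `KatoExpStarFiniteLevel.lean` is multiplicatively closed and
  the trace `Tr_{(ℚ_p ⊗ ℚ(ζ_m))/ℚ_p}` maps it into `ℤ_p` (`norm_trace_le_one_of_mem_cycIntLattice`: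
  `Tr(1 ⊗ ζ^j) = Tr_{ℚ(ζ_m)/ℚ}(ζ^j) ∈ ℤ`, an algebraic integer in `ℚ`), so (hL) holds for
  `τ = trace`, `L = cycIntLattice p m` and ANY `Λ₀ ⊆ L` (`norm_trace_mul_le_one`); and the two scalar
  theorems are restated in exactly the currency of rider (ii) (`(s : ℚ_[p]) ⊗ₜ 1`,
  `((p : ℤ_[p]) ^ (k + 1)) • l`, `l ∈ cycIntLattice p m`): `toZModPow_eq_of_rider_premise`,
  `toZModPow_eq_toZModPow_of_rider_premises`.

NOT here: any `exp*`, `log_ω`, `E₀/E₁`, trace-surjectivity for unramified `K/ℚ₃` (kim3 (α)–(δ)), any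
statement about a curve.  General `p`, general `m` (no `p ∤ m` needed for these scalar statements).

References: S. Bloch, K. Kato (1990) §3 Prop. 3.8, Ex. 3.11 [BlochKato1990]; C.-H. Kim, AJM 148 =
arXiv:2203.12159 §3.3–§3.4.1, proof of Thm. 3.13 [Kim2022StructureSelmer]; C.-H. Kim, K. Nakamura,
JNT 210 (2020) Thm. 2.1 / Cor. 2.4 [KimNakamura2020]; design of record `cells/n1011/ROUTE-1.md`
§53.3/§53.12 (r1; D-53-6/D-53-7), kim3 memo HOME/kim3/KIM3-W2-C1-g11.md §2.4 (SAT₀), §3 (d).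
-/

noncomputable section

-- the cell's Theorems namespace `Summit.BirchSwinnertonDyer.BirchSwinnertonDyer.…` repeats the summit name by design (D-0017)
set_option linter.dupNamespace false

open scoped TensorProduct
open Summit.BirchSwinnertonDyer.Rank1Residual.GaloisImage

namespace Summit.BirchSwinnertonDyer.BirchSwinnertonDyer.Theorems.KimAtThreePortSharedSATCore

/-! ### §1. SAT₀ over an arbitrary `ℚ_p`-algebra -/

section Abstract

variable {p : ℕ} [Fact p.Prime] {A : Type*} [Ring A] [Algebra ℚ_[p] A]

/-- A `p`-adic number of norm `≤ 1` is (the image of) a `p`-adic integer. [folklore] -/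
theorem exists_padicInt_coe_eq_of_norm_le_one {x : ℚ_[p]} (hx : ‖x‖ ≤ 1) :
    ∃ r : ℤ_[p], (r : ℚ_[p]) = x :=
  ⟨⟨x, hx⟩, rfl⟩

/-- **SAT₀ (kim3 KIM3-W2-C1-g11 §2.4 / r1 LEMMA SAT, ROUTE-1 §53.3), scalar core: `(L + M) ∩ ℚ_p ⊆ ℤ_p`.**
For a `ℚ_p`-linear functional `τ` on a `ℚ_p`-algebra `A`, a set `Λ₀ ⊆ A` containing a `τ`-unimodular
element, and `L, M ⊆ A` pairing `τ`-integrally with `Λ₀` (`τ(o·ℓ), τ(μ·ℓ) ∈ ℤ_p`): if the scalar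
`x ∈ ℚ_p` decomposes as `x·1 = o + μ` with `o ∈ L`, `μ ∈ M`, then `‖x‖ ≤ 1`.  Proof (kim3, 8 lines):
`x·τ(ℓ) = τ(x·ℓ) = τ(oℓ) + τ(μℓ) ∈ ℤ_p` and `τ(ℓ)` is a unit.
[cite: Kim2022StructureSelmer, §3.4.1 and the proof of Thm. 3.13 (arXiv v3 pp. 26–27)]
[cite: BlochKato1990, §3 (Prop. 3.8, Ex. 3.11)] -/
theorem norm_le_one_of_algebraMap_eq_add (τ : A →ₗ[ℚ_[p]] ℚ_[p]) {Λ₀ L M : Set A}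
    (hL : ∀ o ∈ L, ∀ ℓ ∈ Λ₀, ‖τ (o * ℓ)‖ ≤ 1) (hM : ∀ μ ∈ M, ∀ ℓ ∈ Λ₀, ‖τ (μ * ℓ)‖ ≤ 1)
    (hu : ∃ ℓ ∈ Λ₀, ‖τ ℓ‖ = 1) {x : ℚ_[p]} {o μ : A} (ho : o ∈ L) (hμ : μ ∈ M)
    (hx : algebraMap ℚ_[p] A x = o + μ) : ‖x‖ ≤ 1 := by
  obtain ⟨ℓ, hℓ, hτℓ⟩ := hu
  have h1 : τ (algebraMap ℚ_[p] A x * ℓ) = x * τ ℓ := by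
    rw [Algebra.algebraMap_eq_smul_one, smul_mul_assoc, one_mul, map_smul, smul_eq_mul]
  have h2 : x * τ ℓ = τ (o * ℓ) + τ (μ * ℓ) := by
    rw [← h1, hx, add_mul, map_add]
  have h3 : ‖x * τ ℓ‖ ≤ 1 := by
    rw [h2]
    exact (Padic.nonarchimedean _ _).trans (max_le (hL o ho ℓ hℓ) (hM μ hμ ℓ hℓ))
  rwa [norm_mul, hτℓ, mul_one] at h3

variable [Module ℤ_[p] A] [IsScalarTower ℤ_[p] ℚ_[p] A]

/-- `ℤ_p`-multiples in `A` are `ℚ_p`-multiples through the inclusion `ℤ_p ⊆ ℚ_p`. [folklore] -/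
theorem padicInt_smul_eq_coe_smul (r : ℤ_[p]) (a : A) : r • a = (r : ℚ_[p]) • a :=
  (IsScalarTower.algebraMap_smul ℚ_[p] r a).symm

/-- **Divisibility form of SAT₀**: if `a ∈ ℤ_p` has `a·1 = p^{k+1}·(o + μ)` in `A` (`o ∈ L`, `μ ∈ M`),
then `p^{k+1} ∣ a`, i.e. `a ≡ 0 (mod p^{k+1})`.
[cite: Kim2022StructureSelmer, the proof of Thm. 3.13 (arXiv v3 pp. 26–27)] -/
theorem toZModPow_eq_zero_of_algebraMap_eq_smul_add (τ : A →ₗ[ℚ_[p]] ℚ_[p]) {Λ₀ L M : Set A}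
    (hL : ∀ o ∈ L, ∀ ℓ ∈ Λ₀, ‖τ (o * ℓ)‖ ≤ 1) (hM : ∀ μ ∈ M, ∀ ℓ ∈ Λ₀, ‖τ (μ * ℓ)‖ ≤ 1)
    (hu : ∃ ℓ ∈ Λ₀, ‖τ ℓ‖ = 1) {a : ℤ_[p]} {k : ℕ} {o μ : A} (ho : o ∈ L) (hμ : μ ∈ M)
    (ha : algebraMap ℚ_[p] A (a : ℚ_[p]) = ((p : ℤ_[p]) ^ (k + 1)) • (o + μ)) :
    PadicInt.toZModPow (k + 1) a = 0 := by
  have hp0 : ((p : ℚ_[p]) ^ (k + 1)) ≠ 0 := pow_ne_zero _ (Nat.cast_ne_zero.mpr (Fact.out : p.Prime).ne_zero)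
  -- the scalar `x := a / p^{k+1}` decomposes as `o + μ`
  set x : ℚ_[p] := (a : ℚ_[p]) / (p : ℚ_[p]) ^ (k + 1) with hx_def
  have hx : algebraMap ℚ_[p] A x = o + μ := by
    have hax : (a : ℚ_[p]) = (p : ℚ_[p]) ^ (k + 1) * x := by
      rw [hx_def, mul_div_cancel₀ _ hp0]
    have h1 : algebraMap ℚ_[p] A (a : ℚ_[p]) = ((p : ℚ_[p]) ^ (k + 1)) • algebraMap ℚ_[p] A x := by
      rw [hax, map_mul, Algebra.smul_def]
    have hP : (((p : ℤ_[p]) ^ (k + 1) : ℤ_[p]) : ℚ_[p]) = (p : ℚ_[p]) ^ (k + 1) := by simp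
    have h2 : ((p : ℚ_[p]) ^ (k + 1)) • algebraMap ℚ_[p] A x = ((p : ℚ_[p]) ^ (k + 1)) • (o + μ) := by
      rw [← h1, ha, padicInt_smul_eq_coe_smul, hP]
    have h3 := congrArg (fun z : A => ((p : ℚ_[p]) ^ (k + 1))⁻¹ • z) h2
    simpa only [inv_smul_smul₀ hp0] using h3
  have hxn : ‖x‖ ≤ 1 := norm_le_one_of_algebraMap_eq_add τ hL hM hu ho hμ hx
  -- hence `a = p^{k+1} · x` with `x ∈ ℤ_p`
  have hmem : a ∈ Ideal.span {((p : ℤ_[p]) ^ (k + 1))} := by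
    rw [Ideal.mem_span_singleton']
    refine ⟨⟨x, hxn⟩, ?_⟩
    apply Subtype.ext
    push_cast
    rw [hx_def, mul_comm, mul_div_cancel₀ _ hp0]
  rw [← PadicInt.ker_toZModPow, RingHom.mem_ker] at hmem
  exact hmem

/-- **The (ii)-shaped scalar conclusion** (the last step of the derivation of rider (ii) of
`KatoExpStarFiniteLevelAt` for Kato's witnesses, kim3 KIM3-W2-C1-g11 §2.4 "(C1.c) from SAT₀"): with
`v = p^t·Λ_{0,r}(y)`, the `exp*`-side input `e·1 − v = p^{k+1}·μ` (`μ ∈ M`: `exp*` commutes with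
restriction and the difference of the two `T`-classes is `p^{k+1}`-divisible) and the PREMISE of (ii)
`v − s·1 = p^{k+1}·l` (`l ∈ L`) give `e ≡ s (mod p^{k+1})` — so `Λfin(loc κ₀) := e mod p^{k+1}` equals
`s mod p^{k+1}`, the CONCLUSION of (ii).  `τ, Λ₀, L, M` and (hL)/(hM)/(hu) displayed.
[cite: Kim2022StructureSelmer, §3.4.1 and the proof of Thm. 3.13 (arXiv v3 pp. 26–27)]
[cite: KimNakamura2020, Thm. 2.1 and Cor. 2.4] -/
theorem toZModPow_eq_of_sub_eq_smul_of_sub_eq_smul (τ : A →ₗ[ℚ_[p]] ℚ_[p]) {Λ₀ : Set A}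
    {L M : Submodule ℤ_[p] A}
    (hL : ∀ o ∈ L, ∀ ℓ ∈ Λ₀, ‖τ (o * ℓ)‖ ≤ 1) (hM : ∀ μ ∈ M, ∀ ℓ ∈ Λ₀, ‖τ (μ * ℓ)‖ ≤ 1)
    (hu : ∃ ℓ ∈ Λ₀, ‖τ ℓ‖ = 1) {e s : ℤ_[p]} {v : A} {k : ℕ} {μ l : A} (hμ : μ ∈ M) (hl : l ∈ L)
    (he : algebraMap ℚ_[p] A (e : ℚ_[p]) - v = ((p : ℤ_[p]) ^ (k + 1)) • μ)
    (hs : v - algebraMap ℚ_[p] A (s : ℚ_[p]) = ((p : ℤ_[p]) ^ (k + 1)) • l) :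
    PadicInt.toZModPow (k + 1) e = PadicInt.toZModPow (k + 1) s := by
  have ha : algebraMap ℚ_[p] A ((e - s : ℤ_[p]) : ℚ_[p]) = ((p : ℤ_[p]) ^ (k + 1)) • (l + μ) := by
    calc algebraMap ℚ_[p] A ((e - s : ℤ_[p]) : ℚ_[p])
        = algebraMap ℚ_[p] A (e : ℚ_[p]) - algebraMap ℚ_[p] A (s : ℚ_[p]) := by
          rw [PadicInt.coe_sub, map_sub]
      _ = (algebraMap ℚ_[p] A (e : ℚ_[p]) - v) + (v - algebraMap ℚ_[p] A (s : ℚ_[p])) := by abel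
      _ = ((p : ℤ_[p]) ^ (k + 1)) • (l + μ) := by rw [he, hs, smul_add, add_comm]
  have h0 := toZModPow_eq_zero_of_algebraMap_eq_smul_add τ (L := (L : Set A)) (M := (M : Set A))
    hL hM hu hl hμ ha
  rwa [map_sub, sub_eq_zero] at h0

/-- **D-53-7 CONSISTENCY (ROUTE-1 §53.12), scalar core**: two premises of rider (ii) for values
`v, v′` differing by `p^{k+1}·ν` with `ν ∈ M` (two `T`-lifts `y, y′ = y + p^{k+1}w` of the same class:
`p^tΛ(y′) − p^tΛ(y) = p^{k+1}·p^tΛ(w)`) — `v − s·1 = p^{k+1}·l`, `v′ − s′·1 = p^{k+1}·l′`, `l, l′ ∈ L` —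
force `s ≡ s′ (mod p^{k+1})`: the scalar of (ii) is well defined.
[cite: Kim2022StructureSelmer, the proof of Thm. 3.13 (arXiv v3 pp. 26–27)] -/
theorem toZModPow_eq_toZModPow_of_premises (τ : A →ₗ[ℚ_[p]] ℚ_[p]) {Λ₀ : Set A}
    {L M : Submodule ℤ_[p] A}
    (hL : ∀ o ∈ L, ∀ ℓ ∈ Λ₀, ‖τ (o * ℓ)‖ ≤ 1) (hM : ∀ μ ∈ M, ∀ ℓ ∈ Λ₀, ‖τ (μ * ℓ)‖ ≤ 1)
    (hu : ∃ ℓ ∈ Λ₀, ‖τ ℓ‖ = 1) {s s' : ℤ_[p]} {v v' : A} {k : ℕ} {ν l l' : A} (hν : ν ∈ M)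
    (hl : l ∈ L) (hl' : l' ∈ L)
    (hvv' : v' - v = ((p : ℤ_[p]) ^ (k + 1)) • ν)
    (hs : v - algebraMap ℚ_[p] A (s : ℚ_[p]) = ((p : ℤ_[p]) ^ (k + 1)) • l)
    (hs' : v' - algebraMap ℚ_[p] A (s' : ℚ_[p]) = ((p : ℤ_[p]) ^ (k + 1)) • l') :
    PadicInt.toZModPow (k + 1) s = PadicInt.toZModPow (k + 1) s' := by
  have e1 : algebraMap ℚ_[p] A (s : ℚ_[p]) = v - ((p : ℤ_[p]) ^ (k + 1)) • l := by
    rw [← hs]; abel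
  have e2 : algebraMap ℚ_[p] A (s' : ℚ_[p]) = v' - ((p : ℤ_[p]) ^ (k + 1)) • l' := by
    rw [← hs']; abel
  have ha : algebraMap ℚ_[p] A ((s - s' : ℤ_[p]) : ℚ_[p]) =
      ((p : ℤ_[p]) ^ (k + 1)) • ((l' - l) + (-ν)) := by
    calc algebraMap ℚ_[p] A ((s - s' : ℤ_[p]) : ℚ_[p])
        = algebraMap ℚ_[p] A (s : ℚ_[p]) - algebraMap ℚ_[p] A (s' : ℚ_[p]) := by
          rw [PadicInt.coe_sub, map_sub]
      _ = (v - ((p : ℤ_[p]) ^ (k + 1)) • l) - (v' - ((p : ℤ_[p]) ^ (k + 1)) • l') := by rw [e1, e2]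
      _ = ((p : ℤ_[p]) ^ (k + 1)) • l' - ((p : ℤ_[p]) ^ (k + 1)) • l - (v' - v) := by abel
      _ = ((p : ℤ_[p]) ^ (k + 1)) • ((l' - l) + (-ν)) := by
          rw [hvv', smul_add, smul_sub, smul_neg]; abel
  have h0 := toZModPow_eq_zero_of_algebraMap_eq_smul_add τ (L := (L : Set A)) (M := (M : Set A))
    hL hM hu (L.sub_mem hl' hl) (M.neg_mem hν) ha
  rwa [map_sub, sub_eq_zero] at h0

end Abstract

/-! ### §2. The semi-local algebra `ℚ_p ⊗_ℚ ℚ(ζ_m)` and its lattice `cycIntLattice p m` -/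

section SemiLocal

variable (p : ℕ) [Fact p.Prime] (m : ℕ) [NeZero m]

set_option backward.isDefEq.respectTransparency false in
/-- `L_int(m) = ℤ_p ⊗ ℤ[ζ_m]` is closed under multiplication (its generators are the powers
`(1 ⊗ ζ_m)^j = 1 ⊗ ζ_m^j`, and `(1 ⊗ ζ)^i · (1 ⊗ ζ)^j = (1 ⊗ ζ)^{i+j}`). [folklore] -/
theorem mul_mem_cycIntLattice {x y : ℚ_[p] ⊗[ℚ] CyclotomicField m ℚ}
    (hx : x ∈ cycIntLattice p m) (hy : y ∈ cycIntLattice p m) : x * y ∈ cycIntLattice p m := by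
  unfold cycIntLattice at hx hy ⊢
  refine Submodule.span_induction
    (p := fun x _ => x * y ∈ Submodule.span ℤ_[p] (Set.range fun j : ℕ =>
      (1 : ℚ_[p]) ⊗ₜ[ℚ] IsCyclotomicExtension.zeta m ℚ (CyclotomicField m ℚ) ^ j)) ?_ ?_ ?_ ?_ hx
  · rintro _ ⟨i, rfl⟩
    refine Submodule.span_induction
      (p := fun y _ => (1 : ℚ_[p]) ⊗ₜ[ℚ] IsCyclotomicExtension.zeta m ℚ (CyclotomicField m ℚ) ^ i * y ∈
        Submodule.span ℤ_[p] (Set.range fun j : ℕ =>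
          (1 : ℚ_[p]) ⊗ₜ[ℚ] IsCyclotomicExtension.zeta m ℚ (CyclotomicField m ℚ) ^ j))
      ?_ ?_ ?_ ?_ hy
    · rintro _ ⟨j, rfl⟩
      dsimp only
      rw [← pow_add]
      exact Submodule.subset_span ⟨i + j, rfl⟩
    · rw [mul_zero]; exact Submodule.zero_mem _
    · intro a b _ _ ha hb
      rw [mul_add]; exact Submodule.add_mem _ ha hb
    · intro r a _ ha
      rw [mul_smul_comm]; exact Submodule.smul_mem _ r ha
  · rw [zero_mul]; exact Submodule.zero_mem _
  · intro a b _ _ ha hb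
    rw [add_mul]; exact Submodule.add_mem _ ha hb
  · intro r a _ ha
    rw [smul_mul_assoc]; exact Submodule.smul_mem _ r ha

set_option backward.isDefEq.respectTransparency false in
omit [NeZero m] in
/-- `Tr_{(ℚ_p ⊗_ℚ ℚ(ζ_m))/ℚ_p}(1 ⊗ z) = Tr_{ℚ(ζ_m)/ℚ}(z)` (trace commutes with base change; Mathlib
`LinearMap.trace_baseChange`). [folklore] -/
theorem trace_one_tmul (z : CyclotomicField m ℚ) :
    Algebra.trace ℚ_[p] (ℚ_[p] ⊗[ℚ] CyclotomicField m ℚ) ((1 : ℚ_[p]) ⊗ₜ[ℚ] z) =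
      algebraMap ℚ ℚ_[p] (Algebra.trace ℚ (CyclotomicField m ℚ) z) := by
  rw [Algebra.trace_apply, Algebra.trace_apply, ← Algebra.baseChange_lmul, LinearMap.trace_baseChange]

set_option backward.isDefEq.respectTransparency false in
/-- `Tr_{ℚ(ζ_m)/ℚ}(ζ_m^j) ∈ ℤ` (the trace of an algebraic integer is a rational integer).
[folklore] -/
theorem exists_int_cast_eq_trace_zeta_pow (j : ℕ) :
    ∃ n : ℤ, (n : ℚ) = Algebra.trace ℚ (CyclotomicField m ℚ)
      (IsCyclotomicExtension.zeta m ℚ (CyclotomicField m ℚ) ^ j) := by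
  have hζ : IsIntegral ℤ (IsCyclotomicExtension.zeta m ℚ (CyclotomicField m ℚ) ^ j) :=
    ((IsCyclotomicExtension.zeta_spec m ℚ (CyclotomicField m ℚ)).isIntegral (NeZero.pos m)).pow j
  have htr : IsIntegral ℤ (Algebra.trace ℚ (CyclotomicField m ℚ)
      (IsCyclotomicExtension.zeta m ℚ (CyclotomicField m ℚ) ^ j)) :=
    Algebra.isIntegral_trace hζ
  obtain ⟨n, hn⟩ := IsIntegrallyClosed.isIntegral_iff.mp htr
  exact ⟨n, by simpa using hn⟩

set_option backward.isDefEq.respectTransparency false in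
/-- **The trace is integral on `L_int(m)`**: `‖Tr_{(ℚ_p ⊗ ℚ(ζ_m))/ℚ_p}(l)‖ ≤ 1` for every
`l ∈ cycIntLattice p m` (generators: `Tr((1 ⊗ ζ)^j) = Tr(1 ⊗ ζ^j) = Tr_{ℚ(ζ_m)/ℚ}(ζ^j) ∈ ℤ`; then
`ℤ_p`-span and the ultrametric inequality). [folklore] -/
theorem norm_trace_le_one_of_mem_cycIntLattice {l : ℚ_[p] ⊗[ℚ] CyclotomicField m ℚ}
    (hl : l ∈ cycIntLattice p m) :
    ‖Algebra.trace ℚ_[p] (ℚ_[p] ⊗[ℚ] CyclotomicField m ℚ) l‖ ≤ 1 := by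
  unfold cycIntLattice at hl
  refine Submodule.span_induction (p := fun l _ => ‖Algebra.trace ℚ_[p] _ l‖ ≤ 1) ?_ ?_ ?_ ?_ hl
  · rintro _ ⟨j, rfl⟩
    obtain ⟨n, hn⟩ := exists_int_cast_eq_trace_zeta_pow m j
    dsimp only
    rw [Algebra.TensorProduct.tmul_pow, one_pow, trace_one_tmul, ← hn, map_intCast]
    exact Padic.norm_int_le_one n
  · rw [map_zero, norm_zero]; exact zero_le_one
  · intro a b _ _ ha hb
    rw [map_add]
    exact (Padic.nonarchimedean _ _).trans (max_le ha hb)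
  · intro r a _ ha
    rw [padicInt_smul_eq_coe_smul, map_smul, smul_eq_mul, norm_mul]
    exact mul_le_one₀ (PadicInt.norm_le_one r) (norm_nonneg _) ha

/-- **(hL) for the trace on `L_int(m)`**: for ANY `Λ₀ ⊆ L_int(m)`, `Tr(o·ℓ) ∈ ℤ_p` for `o ∈ L_int`,
`ℓ ∈ Λ₀` (kim3 §2.4 (β): `Λ₀ = log_ω E₀ ⊆ 𝓞_K`). [folklore] -/
theorem norm_trace_mul_le_one {Λ₀ : Set (ℚ_[p] ⊗[ℚ] CyclotomicField m ℚ)}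
    (hΛ₀ : Λ₀ ⊆ cycIntLattice p m) :
    ∀ o ∈ (cycIntLattice p m : Set (ℚ_[p] ⊗[ℚ] CyclotomicField m ℚ)), ∀ ℓ ∈ Λ₀,
      ‖Algebra.trace ℚ_[p] (ℚ_[p] ⊗[ℚ] CyclotomicField m ℚ) (o * ℓ)‖ ≤ 1 :=
  fun _ ho _ hℓ => norm_trace_le_one_of_mem_cycIntLattice p m (mul_mem_cycIntLattice p m ho (hΛ₀ hℓ))

set_option backward.isDefEq.respectTransparency false in
omit [NeZero m] in
/-- The scalar `s ⊗ 1` of rider (ii) is `algebraMap ℚ_p (ℚ_p ⊗ ℚ(ζ_m)) s`. [folklore] -/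
theorem coe_tmul_one_eq_algebraMap (s : ℚ_[p]) :
    (s ⊗ₜ[ℚ] (1 : CyclotomicField m ℚ) : ℚ_[p] ⊗[ℚ] CyclotomicField m ℚ) =
      algebraMap ℚ_[p] (ℚ_[p] ⊗[ℚ] CyclotomicField m ℚ) s := by
  rw [Algebra.TensorProduct.algebraMap_apply]
  rfl

set_option backward.isDefEq.respectTransparency false in
/-- **Rider (ii), SCALAR STEP in its own currency** (kim3 KIM3-W2-C1-g11 §2.4 "(C1.c) from SAT₀" /
r1 ROUTE-1 §53.3, the `exp*`-free part).  In the semi-local algebra `ℚ_p ⊗_ℚ ℚ(ζ_m)` of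
`KatoExpStarFiniteLevelAt` (ii), with `τ = trace`, `L = cycIntLattice p m`, a set `Λ₀ ⊆ L_int` with a
trace-unimodular element (DISPLAYED: kim3 (γ)(δ)) and a `ℤ_p`-submodule `M ⊆ Λ₀^∨` (DISPLAYED: [BK90]
Prop. 3.8 + local duality): the `exp*`-side input `e ⊗ 1 − v = p^{k+1}·μ`, `μ ∈ M`, and the PREMISE of
(ii) `∃ l ∈ cycIntLattice p m, v − s ⊗ 1 = p^{k+1}·l` (with `v := p^t · Λ 0 r y`) give
`PadicInt.toZModPow (k+1) e = PadicInt.toZModPow (k+1) s` — the CONCLUSION of (ii) for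
`Λfin(loc κ₀) := toZModPow (k+1) e`.  Nothing about a curve is asserted.
[cite: Kim2022StructureSelmer, §3.4.1 and the proof of Thm. 3.13 (arXiv v3 pp. 26–27)]
[cite: KimNakamura2020, Thm. 2.1 and Cor. 2.4] [cite: BlochKato1990, §3 (Prop. 3.8, Ex. 3.11)] -/
theorem toZModPow_eq_of_rider_premise {Λ₀ : Set (ℚ_[p] ⊗[ℚ] CyclotomicField m ℚ)}
    (hΛ₀ : Λ₀ ⊆ cycIntLattice p m)
    (hu : ∃ ℓ ∈ Λ₀, ‖Algebra.trace ℚ_[p] (ℚ_[p] ⊗[ℚ] CyclotomicField m ℚ) ℓ‖ = 1)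
    {M : Submodule ℤ_[p] (ℚ_[p] ⊗[ℚ] CyclotomicField m ℚ)}
    (hM : ∀ μ ∈ M, ∀ ℓ ∈ Λ₀, ‖Algebra.trace ℚ_[p] (ℚ_[p] ⊗[ℚ] CyclotomicField m ℚ) (μ * ℓ)‖ ≤ 1)
    {e s : ℤ_[p]} {v : ℚ_[p] ⊗[ℚ] CyclotomicField m ℚ} {k : ℕ}
    (he : ∃ μ ∈ M, ((e : ℚ_[p]) ⊗ₜ[ℚ] (1 : CyclotomicField m ℚ)) - v = ((p : ℤ_[p]) ^ (k + 1)) • μ)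
    (hval : ∃ l ∈ cycIntLattice p m,
      v - ((s : ℚ_[p]) ⊗ₜ[ℚ] (1 : CyclotomicField m ℚ)) = ((p : ℤ_[p]) ^ (k + 1)) • l) :
    PadicInt.toZModPow (k + 1) e = PadicInt.toZModPow (k + 1) s := by
  obtain ⟨μ, hμ, he⟩ := he
  obtain ⟨l, hl, hs⟩ := hval
  rw [coe_tmul_one_eq_algebraMap] at he hs
  exact toZModPow_eq_of_sub_eq_smul_of_sub_eq_smul (Algebra.trace ℚ_[p] _) (L := cycIntLattice p m)
    (fun o ho ℓ hℓ => norm_trace_mul_le_one p m hΛ₀ o ho ℓ hℓ) hM hu hμ hl he hs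

set_option backward.isDefEq.respectTransparency false in
/-- **D-53-7 in its own currency** (ROUTE-1 §53.12): two premises of rider (ii),
`∃ l ∈ L_int, v − s ⊗ 1 = p^{k+1}·l` and `∃ l′ ∈ L_int, v′ − s′ ⊗ 1 = p^{k+1}·l′`, for values with
`v′ − v ∈ p^{k+1}·M` give `toZModPow (k+1) s = toZModPow (k+1) s′` (same displayed `Λ₀`, `M`).
[cite: Kim2022StructureSelmer, the proof of Thm. 3.13 (arXiv v3 pp. 26–27)] -/
theorem toZModPow_eq_toZModPow_of_rider_premises {Λ₀ : Set (ℚ_[p] ⊗[ℚ] CyclotomicField m ℚ)}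
    (hΛ₀ : Λ₀ ⊆ cycIntLattice p m)
    (hu : ∃ ℓ ∈ Λ₀, ‖Algebra.trace ℚ_[p] (ℚ_[p] ⊗[ℚ] CyclotomicField m ℚ) ℓ‖ = 1)
    {M : Submodule ℤ_[p] (ℚ_[p] ⊗[ℚ] CyclotomicField m ℚ)}
    (hM : ∀ μ ∈ M, ∀ ℓ ∈ Λ₀, ‖Algebra.trace ℚ_[p] (ℚ_[p] ⊗[ℚ] CyclotomicField m ℚ) (μ * ℓ)‖ ≤ 1)
    {s s' : ℤ_[p]} {v v' : ℚ_[p] ⊗[ℚ] CyclotomicField m ℚ} {k : ℕ}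
    (hvv' : ∃ ν ∈ M, v' - v = ((p : ℤ_[p]) ^ (k + 1)) • ν)
    (hval : ∃ l ∈ cycIntLattice p m,
      v - ((s : ℚ_[p]) ⊗ₜ[ℚ] (1 : CyclotomicField m ℚ)) = ((p : ℤ_[p]) ^ (k + 1)) • l)
    (hval' : ∃ l' ∈ cycIntLattice p m,
      v' - ((s' : ℚ_[p]) ⊗ₜ[ℚ] (1 : CyclotomicField m ℚ)) = ((p : ℤ_[p]) ^ (k + 1)) • l') :
    PadicInt.toZModPow (k + 1) s = PadicInt.toZModPow (k + 1) s' := by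
  obtain ⟨ν, hν, hvv'⟩ := hvv'
  obtain ⟨l, hl, hs⟩ := hval
  obtain ⟨l', hl', hs'⟩ := hval'
  rw [coe_tmul_one_eq_algebraMap] at hs hs'
  exact toZModPow_eq_toZModPow_of_premises (Algebra.trace ℚ_[p] _) (L := cycIntLattice p m)
    (fun o ho ℓ hℓ => norm_trace_mul_le_one p m hΛ₀ o ho ℓ hℓ) hM hu hν hl hl' hvv' hs hs'

end SemiLocal

end Summit.BirchSwinnertonDyer.BirchSwinnertonDyer.Theorems.KimAtThreePortSharedSATCore

end
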